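import Mathlib
import HarnessLib
import HarnessLib.Audit
import Summits.ValiantsHypothesis.Statement
import Literature.Computability.AlgebraicComplexity.TavenasHutchinsonFamily
import HarnessLib.Audit.Status.Attr

/-!
Route: SOSTau

DORMANT since 2026-08-29T19:43:55Z (census g0: costume|duplicate of —; reader census-reader-27-g0) — unstaffed, not closed; items shared with open routes are served there. `ledger route dormant <id> --off` reactivates.

# Route SOSTau — Dutta's SOS-τ — linearly few real zeros for sparse weighted squares, magnified
through Tavenas' all-real-rooted V_n

PROGRAM-COMPLETION LENS (Dutta 2021, CSR 2021 = Dutta2021; restated by the field's surveyor as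
Burgisser2024Completeness Conj. 4.2;
not hosted by any of the 57 listed routes, kept "in reserve" as the sibling of route RealTau and
named by FeketeSOS's kill criterion (v)).
It suffices to show X = X1 ∧ X2. X1 (crux `SOSTau`, the author's ONE named gap, Dutta2021 Conj. 1
verbatim): there is c such that every
real weighted sum of squares Σ_{i<s} a_i g_i² (a_i ∈ ℝ, g_i ∈ ℝ[X]) has at most c·Σ_i |supp g_i|
distinct real zeros — a LINEAR,
Descartes-sharp bound at depth two (the trivial bound is the quadratic 2·Σ|supp g_i|²). X2 (crux
`HutchinsonMagnification`, the
printed reduction Dutta2021 Thm 2 = Lemmas 1, 3, 4, 10, specialised and typed over REAL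
representations): if the Tavenas–Hutchinson
family V_n = Σ_{i<2^n} 2^{2i(2^n−1−i)} X^i (tree `tavenasV`; = Dutta's Kurtz family f_d at d = 2^n −
1) needs support-sum ≥ η·2^n in
every real weighted SOS representation, for some η > 0 and all large n, then VP_ℂ ≠ VNP_ℂ. Target
`HutchinsonSOSHard` = that linear
sparse-SOS hardness of V_n, the weakest V_n-specific statement the deciding theorem consumes; X1 ⇒
target because ALL 2^n − 1 zeros of
V_n are real (tree theorem `card_roots_toFinset_map_tavenasV`), proved inside `closes`.
Lean: `(∃ c : ℕ, ∀ (s : ℕ) (a : Fin s → ℝ) (g : Fin s → Polynomial ℝ), (∑ i, Polynomial.C (a i) * g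
i ^ 2).roots.toFinset.card ≤ c * ∑ i, (g i).support.card) ∧ ((∃ η : ℝ, 0 < η ∧ ∃ n₀ : ℕ, ∀ n : ℕ, n₀
≤ n → ∀ (s : ℕ) (a : Fin s → ℝ) (g : Fin s → Polynomial ℝ), (∑ i, Polynomial.C (a i) * g i ^ 2) =
(Literature.Computability.AlgebraicComplexity.tavenasV n).map (Int.castRingHom ℝ) → η * 2 ^ n ≤ ∑ i,
((g i).support.card : ℝ)) → ValiantsHypothesis)`

## Assembly
Pure logic plus fourteen lines of real arithmetic over ONE tree theorem, certified natively
(glue.lean `closes (h₁ : SOSTau)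
(h₂ : HutchinsonMagnification) : ValiantsHypothesis`, sorry-free, Sketch.lean rc 0): from h₁ obtain
c; set η = 1/(2(c+1)), n₀ = 1; for a
real representation of V_n (n ≥ 1) rewrite the zero count by `card_roots_toFinset_map_tavenasV` to
get 2^n − 1 ≤ c·S in ℕ, cast to ℝ,
and conclude η·2^n ≤ S (nlinarith); this is the hypothesis of h₂, whose conclusion is literally
`ValiantsHypothesis`. Both cruxes are
load-bearing binders; the target HutchinsonSOSHard is DERIVED inside `closes` (directly claimable; a
direct proof of it re-glues `closes`
to `(h : HutchinsonSOSHard) (h₂)` in one edit).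

Rationale: WHY THIS LINE. Dutta2021 (Thm 2, with Lemmas 1, 3, 4, 10; Burgisser2024Completeness §4.6 Conj. 4.2
"remarkably … implies VP ≠ VNP over ℂ and explicit
rigid matrices") prints a COMPLETE reduction of VP_ℂ ≠ VNP_ℂ to one conjecture of real fewnomial
theory: assume VP_ℂ = VNP_ℂ; the base-k
digit lift P_{n,k} of V_n is in VNP_ℂ (constants free), hence in VP_ℂ; ONE
Valiant–Skyum–Berkowitz–Rackoff middle cut P = Σ_{i≤s} Q_i R_i
(deg ∈ [d/3, 2d/3]) polarised into squares and pushed down by the inverse digit map gives V_n = Σ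
c_i g_i² over ℂ with support-sum
O(d^{6/7} log² d) = o(2^n); Lemma 10 realifies (×4); but V_n has 2^n − 1 real zeros
(Hutchinson/Kurtz, a_i² = 16 a_{i−1}a_{i+1}), so SOS-τ
forces support-sum ≥ (2^n − 1)/c — contradiction. Constants are free throughout (real zeros ignore
coefficient size), no GRH, no counting
hierarchy, and — unlike Koiran–Tavenas (route RealTau) — NO DEPTH REDUCTION: the magnification needs
only a lower bound above the trivial
√d (DuttaSaxenaThierauf2021 Thm 6, DuttaSaxenaThierauf2024), here supplied linearly. Imported area:
real algebraic geometry of fewnomials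
(Descartes/sign variations — tree `RealTauKnownCases`; Voorhoeve–van der Poorten Wronskian counting
— KoiranPortierTavenas2015; Kac–Rice
average-case counting — BriquelBurgisser2020) applied to SUMS OF SQUARES, where the two-square case
is a theorem (Dutta2021 Thm 9) and
the smallest open case is Chattopadhyay's fg + 1 problem. WHY NOW (per gap): for X2, the tree
already holds the witness with its exact real
root count (`TavenasHutchinsonFamily`, discharged for TauConst/RealTau) and the FeketeSOS programme
has landed the DST transfer machinery as
accepted stubs (VSBR cut + set-multilinear projection + polarised SOS + digit Kronecker:
FeketeSOSSOSMagnificationStubPolarisedSOS /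
StubDigitKronecker / StubBudget), so X2 is an L-sized adaptation, not research; for X1, sparse
Descartes and the k = 1 real-τ case are tree
theorems, the average case is settled in print (BriquelBurgisser2020-type, Dutta2021 §1.1), and the
compute lane can run the Chebyshev
sparse-SOS search that calibrates c (Cheapest falsifier). Nothing in the negatives index
(UlrichPadded, Elusive, GrenetRigidity) concerns
zero counting or SOS.

RANKED CRUXES. #0 HutchinsonSOSHard (target) — linear sparse-SOS hardness of the Tavenas–Hutchinson
family: there are η > 0 and n₀ such that for all n ≥ n₀ every real weighted sum-of-squares
representation Σ_{i<s} a_i g_i² = V_n has support-sum Σ_i |supp g_i| ≥ η·2^n (trivial: ≥ √(2^n);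
Dutta's threshold for magnification: d^{1/2+δ}; implied by SOSTau with η = 1/(2(c+1)), proved in
Sketch.lean `ofSOSTau_proof` and inside `closes`). (why it might fail: V_n's digit lift is a
rank-one theta/Ising sum Σ 4^{−k²}·(monomials); a Gauss-sum or Jacobi-theta product identity could
write V_n with few sparse squares of support o(2^n), exactly as Σ_{m<p} x^m is 4 squares of support
O(√p).) [Dutta2021, DuttaSaxenaThierauf2024, Tavenas2014, Kurtz1992]
#2 SOSTau (crux) — Dutta's SOS-τ-conjecture (Dutta2021 Conj. 1; Burgisser2024Completeness Conj.
4.2), typed over representations so that no `Inf` is needed: there is an absolute c such that for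
all s, all real weights a : Fin s → ℝ and all g : Fin s → ℝ[X], the number of distinct real zeros of
Σ_i a_i g_i² is at most c · Σ_i |supp g_i|. [difficulty: open-problem] (why it might fail: Chebyshev
T_{2^k} = 2T_{2^{k−1}}² − 1 already forces c ≥ 4 (2^k zeros, support-sum 2^{k−2}+2); three squares
contain the open fg+1 problem; one sparse-SOS identity for a Chebyshev/Dickson tower with support
o(2^k), s ≥ 3, kills it.) [Dutta2021, Burgisser2024Completeness, KoiranPortierTavenas2015,
BriquelBurgisser2020, Koiran2011]
#3 HutchinsonMagnification (crux) — Dutta2021 Thm 2 for the tree's witness, over REAL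
representations and at the LINEAR threshold: linear sparse-SOS hardness of V_n (the body of
HutchinsonSOSHard, inlined) implies VP_ℂ ≠ VNP_ℂ. Printed chain: VP_ℂ = VNP_ℂ ⇒ the kn-variate
multilinear digit lift P_{n,k} = φ_{n,k}(V_n) ∈ VNP_ℂ (Lemma 3; constants 2^{2i(d−i)} free) ⊆ VP_ℂ ⇒
VSBR middle cut P_{n,k} = Σ_{i≤s} c_i Q_i², deg Q_i ≤ 2n/3, s = O(size·n²) (Lemma 1) ⇒ V_n = Σ c_i
ψ(Q_i)² over ℂ with support-sum ≤ s·C(kn+2n/3, 2n/3) = O(d^{6/7} log² d) (Lemma 4, k ≥ 5^14 + 1) ⇒ a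
REAL representation with ≤ 4× that support (Lemma 10) ⇒ contradiction with η·2^n for large n.
[difficulty: L] (why it might fail: Printed over ℂ, ε = 1, size > d^{1/7}; as TYPED it needs Lemma
10 (ℂ→ℝ ×4), VNP_ℂ-membership of the digit lift (free constants) and the middle cut for `complexity`
with p-bounded degree (homogenisation ×d²); FeketeSOS's twin took 7 stubs; an exponent slip forces a
restatement.) [Dutta2021, DuttaSaxenaThierauf2021, DuttaSaxenaThierauf2024, Tavenas2014,
Burgisser2000]
#9 ComplexToRealSOS (support) — Dutta2021 Lemma 10, quantitative: a complex weighted SOS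
representation Σ_{i<s} a_i g_i² of a REAL polynomial f yields a real one with support-sum at most
4·Σ|supp g_i| (write g_i = u_i + i v_i, a_i = α_i + iβ_i; Re(a_i g_i²) = α_i(u_i² − v_i²) −
(β_i/2)((u_i+v_i)² − (u_i−v_i)²), all four squares supported inside supp g_i). First birth stub of
HutchinsonMagnification. [difficulty: provable-now] [Dutta2021]
#9 CollapseCheapComplexSOS (support) — Dutta2021 Lemmas 1 + 3 + 4 for V_n (the L-sized core of
HutchinsonMagnification, its second birth stub): if VP_ℂ = VNP_ℂ then for every η > 0, infinitely
often in n, V_n has a complex weighted SOS representation of support-sum < η·2^n (digit lift in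
VNP_ℂ, hence VP_ℂ; VSBR middle cut; polarisation; inverse digit map; support count O(d^{6/7} log²
d)). Reusable tree pieces: FeketeSOSSOSMagnificationStubPolarisedSOS, StubDigitKronecker, StubBudget
(accepted for FeketeSOS). [difficulty: L] [Dutta2021, DuttaSaxenaThierauf2024, Burgisser2000]
#9 OfSOSTau (support) — SOS-τ gives the target: with c from SOSTau take η = 1/(2(c+1)) and n₀ = 1; a
real representation of V_n has 2^n − 1 distinct real zeros (tree
`card_roots_toFinset_map_tavenasV`), so 2^n − 1 ≤ c·S and S ≥ 2^n/(2(c+1)). PROVED sorry-free in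
Sketch.lean (`ofSOSTau_proof`, 14 lines) and inlined in `closes`. [difficulty: provable-now]
[Dutta2021, Tavenas2014]
#9 TwoSquares (support) — Dutta2021 Thm 9 (the largest proved case of SOS-τ): a weighted sum of TWO
sparse squares a₁g₁² + a₂g₂² has at most c·(|supp g₁| + |supp g₂|) distinct real zeros for an
absolute c (opposite signs: difference-of-squares factorisation into two (t₁+t₂)-sparse factors +
sparse Descartes; equal signs: SameSignSquares). The calibration rung below which refuters need not
look. [difficulty: provable-now] [Dutta2021, Koiran2011]
#9 SameSignSquares (support) — weighted sums of sparse squares with all weights ≥ 0 have at most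
2·Σ|supp g_i| distinct real zeros (every zero is a common zero of the g_i with a_i ≠ 0; sparse
Descartes `card_roots_toFinset_le_of_card_support` on one of them). With TwoSquares it confines the
conjecture's difficulty to s ≥ 3 with mixed signs; the s = 1 case (c = 2) is PROVED in Sketch.lean
(`oneSquare`, `sosTau_one_square`). [difficulty: provable-now] [Dutta2021, Koiran2011]
#9 ChebyshevCalibration (support) — the barrier witness of
`Literature.Barriers.ValiantsHypothesis.TauRealZeros` re-measured in the SOS model: T_{2^k} =
2·T_{2^{k−1}}² − 1·1² is a two-square representation of support-sum 2^{k−2} + 2 of a polynomial with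
2^k distinct real zeros (tree `card_realRoots_chebyshevT`; Mathlib `Polynomial.Chebyshev`), hence
every admissible SOS-τ constant satisfies c ≥ 4 — the conjecture lives exactly at the Chebyshev
ratio, and two-square representations can never beat it (TwoSquares' factorisation gives ≤ 26 < 32
zeros at k = 5). [difficulty: provable-now] [Koiran2011, Burgisser2024Completeness, Dutta2021]

TWO-LAYER PLAN. Foreseen, not filed (k ≤ 3, depth 1). SOSTau ⇐ DominantNoZero → TieCount → SOSTau —
the birth skeleton (bc/SOSTau_birth.lean, composition
PROVED): at a point where one weighted square strictly exceeds the sum of the moduli of the others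
there is no zero (provable, M), so every
real zero is a TIE zero; the open core TieCount ("tie zeros ≤ c·Σ|supp g_i|") then splits again by
archimedean tropicalisation — the
max of the s convex piecewise-linear functions log|a_i| + 2·trop(g_i)(u) has ≤ Σ|supp g_i| − 1
breakpoints, so ties live in ≤ 2S scale
windows of bounded length (provable), and the residual statement is a PER-WINDOW Wronskian/Rolle
count (KoiranPortierTavenas2015 Thm 9/12
shape). HutchinsonMagnification ⇐ ComplexToRealSOS → CollapseCheapComplexSOS →
HutchinsonMagnification (bc/HutchinsonMagnification_birth.lean,
composition PROVED, both children already filed as supports); CollapseCheapComplexSOS ⇐ DigitLiftVNP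
→ MiddleCutSOS → SupportBudget
(the FeketeSOS stub architecture, k = 3).

KILL CRITERIA. (i) An explicit family of real weighted sparse SOS representations with Z/S → ∞ (Z
distinct real zeros, S support-sum) refutes SOSTau —
close `refuted:SOSTau` unless the family has s → ∞ only polynomially slower than Z, in which case
restate as the s-weighted form
Z ≤ c·s^a·S that the magnification still tolerates (s ≤ d^{1/7+o(1)} in Lemma 4) via `--restate`;
the witness goes to
Literature/Barriers next to TauRealZeros as its depth-2 extension, and kills Dutta2021 Conj. 1 in
print (informative for RealTau and
FeketeSOS too). (ii) A cheap real SOS representation of V_n itself (support o(2^n)) refutes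
HutchinsonSOSHard and SOSTau at once and
exhibits the theta/Gauss identity HutchinsonSOSHard fears — same close; RealTau.VnSparseHard and
SymmetroidDescartes' witness survive
only if the identity is not depth-4/pencil-cheap. (iii) HutchinsonMagnification cannot be refuted
short of ¬VH; a formalisation bounce
on the exponent shape is repaired by `--restate` with the budget the proof yields (the glue
tolerates any o(2^n)). Mooted by VH elsewhere;
SUPERSEDES nothing and is superseded by nothing: RealTau (depth 4, refined SPS bound) and this route
(depth 2, linear SOS bound) die or
live independently.

NOT DECOMPOSED YET. The per-window Wronskian count and the scale-window lemma (layer-2 children of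
SOSTau, above); the degree-restricted form of SOS-τ that
already suffices (Dutta2021 §3.2 Remark: deg g_i = O(d log d)) — a WEAKER crux to swap in by
`--restate` if the unrestricted form dies
on high-degree identities; the s-weighted form Z ≤ c·s^a·S (also sufficient); the rigidity corollary
(Dutta2021 Thm 1: SOS-τ ⇒ explicit
(εn, n^{1+δ})-rigid matrices from Pochhammer–Wilkinson) — a consequence, not used toward VH,
recorded for the PneNP/rigidity summit;
the SOC (sum-of-cubes) τ-conjecture and PIT (Dutta2021 Thm 5) — not this summit. Definitions needed:
none (Polynomial.roots, support,
tavenasV, VP, VNP exist).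

CHEAPEST FALSIFIER. (a) In Lean, done this session: the one-square case of SOSTau with c = 2 is
PROVED (Sketch.lean `oneSquare`/`sosTau_one_square`, from the
tree's sparse Descartes `card_roots_toFinset_le_of_card_support`), and `closes`, `ofSOSTau_proof`,
`assembly_proof` are sorry-free — the
definitions compute. (b) For refuters, ONE batched kit job — the CHEBYSHEV SPARSE-SOS SEARCH: for k
= 6, 7 and s = 3, 4, decide whether
T_{2^k} = Σ_{i<s} a_i g_i² has a real solution with prescribed supports of total size S < 2^{k−2}
(fix supports ⊂ even degrees ≤ 2^k,
solve the quadratic coefficient system numerically / by Gröbner elimination; monomial counting gives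
S ≥ 2^{k/2} and the TwoSquares
factorisation shows s = 2 never beats ratio 4, so (k, s) = (6, 3) with S ∈ [8, 16) is the first live
cell). A hit refutes c = 4 and, if it
iterates along the tower, SOSTau; a certified miss is new calibration data for the barrier file. (c)
The fg + 1 search already proposed
by RealTau (3-sparse f, g, exponents ≤ 40) doubles as the s = 3 mixed-sign probe of SOSTau. (d)
Lookup run: Burgisser2024Completeness §4.6 and Dutta2021 §1.1 record no counterexample;
frontier.json: nothing on SOS-τ.

NUMBERS. Trivial bounds: √|f|₀ ≤ S_ℝ(f) ≤ 2|f|₀ + 2 (f = (f+1)²/4 − (f−1)²/4); Z(f) ≤ 2|f|₀ − 1 ≤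
2S² (sparse Descartes, tree). Proved cases: s = 1
with c = 2 (Sketch.lean); s = 2, c = O(1) (Dutta2021 Thm 9); same-sign any s, c = 2. Calibration:
T_{2^k}: Z = 2^k, S ≤ 2^{k−2} + 2
(ratio → 4). Witness: V_n = tavenasV n, deg 2^n − 1, exactly 2^n − 1 distinct real zeros (tree),
trivial SOS support 2·2^n + 2.
Magnification budget (Dutta2021 Lemma 4): k ≥ 5^14 + 1, size > d^{1/7}, s = O(d^{1/7} log² d), C(kn
+ 2n/3, 2n/3) ≤ d^{5/7}, so
S_ℂ(V_n) = O(d^{6/7} log² d) under VP_ℂ = VNP_ℂ, against η·d from SOSTau. Items at open: 10 (1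
target, 2 cruxes, 6 supports, 1 assembly).

DEFINITION REQUESTS. None. (`S_ℝ(f)` as an `Inf` is deliberately NOT requested: every item
quantifies over representations.)

Novelty: Searches (2026-08-17): `lean search 'SOSTau|SoS_τ|SOS-τ|Dutta2021'` over tree + Mathlib (hits only
in comments of Theses/RealTau.lean:
"sibling route, not an item here"); grep of all 73 Theses for real τ / Wronskian / Descartes / SOS
(TauConst decoration TauReal; FeketeSOS
support-sum via char p; RealTau, LacunarySymmetroid, SymmetroidDescartes opened today by sibling
lens seats on depth-4 SPS / lacunary
symmetric pencils); `lit galaxy search "largish sum-of-squares implies circuit hardness" --star all`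
(2: the CSR 2021 volume
panama:466210110046231 — Dutta2021 read on the page, chars 270000–330000: Conj. 1, Thms 1–2, 9,
Lemmas 1, 3, 4, 10 — and DDS border depth-3);
`lit galaxy search "tau-conjecture for sum-of-squares" --star all` (0); `lit read arXiv:2406.06217
--grep conjecture` (Burgisser 2024 §4.6
Conj. 4.1/4.2, §7); `lit read arXiv:2606.25121` (Bürgisser 2026, pp. 2–5, 18–19: constant-free
BSS→Valiant only); `lit search --source
openalex|s2|arxiv` rate-limited this session (HTTP 429 ×2, 0 arXiv hits) — recorded;
programmes_lit.json (26) and claimed_proofs (15)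
generic; `ledger negatives` (4, none on zero counting). BC4: `exact?` against Mathlib + 7 Literature
modules + all 73 Theses fails for both
cruxes and the target.
Nearest prior art found: Dutta2021 (doi:10.1007/978-3-030-79416-3_5) — the programme verbatim (Conj.
1, Thm 2); DuttaSaxenaThierauf2021/2024
(the magnification at threshold d^{1/2+ε}, hosted for the Fekete family by route FeketeSOS);
Tavenas2014 / Koiran  [refs: 10.1007/978-3-030-79416-3_5, 2406.06217, 2606.25121, doi:10.1007/978-3-030-79416-3_5, Dutta2021, DuttaSaxenaThierauf2021, Tavenas2014, Koiran2011]

Barriers (technique_class: real-root-counting, sparse-sos, middle-cut-magnification): - technique_class: real-root-counting, sparse-sos, middle-cut-magnification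
- Literature.Barriers.ValiantsHypothesis.TauRealZeros: evaded AS TYPED and met AT THE THRESHOLD —
the barrier refutes real-zero bounds in the constant-free gate count τ (Chebyshev T_{2^k}: τ ≤ 3k,
2^k zeros; strengthened in the file to every subexponential shape and to separated zeros); SOSTau
charges the support-sum of the representation, in which the barrier's own witness costs 2^{k−2} + 2
for 2^k zeros (ratio 4, support ChebyshevCalibration): consistent with the conjecture, fixing c ≥ 4,
and by the TwoSquares factorisation no two-square representation can do better; the bet is that no s
≥ 3 sparse-SOS identity iterates the squaring trick below linear support (Cheapest falsifier (b)).
- Literature.Barriers.ValiantsHypothesis.DepthReductionChasm: NOT engaged — the reduction uses one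
VSBR middle cut (polynomial loss) and the inverse digit map, never Agrawal–Vinay/Tavenas depth
reduction; the hardness threshold it needs is d^{1/2+δ} against the trivial √d
(DuttaSaxenaThierauf2021 Thm 6), not 2^{ω(√d log d)}; this is the structural difference from
RealTau, which lives in the chasm gap.
- Literature.Barriers.ValiantsHypothesis.AlgebraicNaturalProofs: it does not evade it by fiat; the
bet is non-constructivity — {f : S_ℂ(f) ≤ s} is a countable union over support patterns of images of
bilinear maps, no polynomial-degree equations for it are known, and the property is applied to ONE
VNP witness rather than

Novelty grade: known — route-review (refuter rreview-0817T02-14): the line 'SOS-τ ⇒ VP_C ≠ VNP_C via the Kurtz/Hutchinson family f_d = Σ 2^{2i(d−i)} x^i' is PUBLISHED AS SUCH for this summit — Dutta, CSR 2021 (LNCS 12730) Conj. 1 + Thm. 2 (§3.2: same witness, same chain Lemma 3 Valiant criterion / Lemma 1 middle cut / Lem (refuter refuter-rreview-0817T02-14-0, 2026-08-17T04:00:52Z; prior: doi:10.1007/978-3-030-79416-3_5, arXiv:2406.06217, doi:10.4230/lipics.itcs.2021.23)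

History (route lifecycle, newest last):
- 2026-08-29T19:43:55Z · DORMANT — census g0: costume|duplicate of —; reader census-reader-27-g0 (operator:999:1838192)

sub-problem: ValiantsHypothesis · status: dormant · opened planner-plan-lens3-ValiantsHypothesis-complete-g2-0 2026-08-17T02:58:10Z · rev 0 · ledger route-ValiantsHypothesis-SOSTau
GENERATED by the gate from the ledger (D-0016/17). Provers cite these decls: `theorem foo : Summit.ValiantsHypothesis.ValiantsHypothesis.Theses.SOSTau.<Decl> := …` in Summits/ValiantsHypothesis/ValiantsHypothesis/Theorems/<Name>.lean.
-/

namespace Summit.ValiantsHypothesis.ValiantsHypothesis.Theses.SOSTau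

open scoped BigOperators Topology Manifold Classical MeasureTheory ProbabilityTheory Matrix InnerProductSpace ComplexConjugate ContinuousMap
open Filter Set Function TopologicalSpace MeasureTheory

attribute [summit_statement] _root_.ValiantsHypothesis

open Literature.PNP

/-- item stmt-ValiantsHypothesis-18747 · target · rank 0 · open · by planner
why it might fail: V_n's digit lift is a rank-one theta/Ising sum Σ 4^{−k²}·(monomials); a Gauss-sum or Jacobi-theta product identity could write V_n with few sparse squares of support o(2^n), exactly as Σ_{m<p} x^m is 4 squares of support O(√p).
sources: Dutta2021, DuttaSaxenaThierauf2024, Tavenas2014, Kurtz1992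
[target] linear sparse-SOS hardness of the Tavenas–Hutchinson family: there are η > 0 and n₀ such
that for all n ≥ n₀ every real weighted sum-of-squares representation Σ_{i<s} a_i g_i² = V_n has
support-sum Σ_i |supp g_i| ≥ η·2^n (trivial: ≥ √(2^n); Dutta's threshold for magnification:
d^{1/2+δ}; implied by SOSTau with η = 1/(2(c+1)), proved in Sketch.lean `ofSOSTau_proof` and inside
`closes`). -/
@[route_item "route-ValiantsHypothesis-SOSTau"]
def HutchinsonSOSHard : Prop :=
  ∃ η : ℝ, 0 < η ∧ ∃ n₀ : ℕ, ∀ n : ℕ, n₀ ≤ n → ∀ (s : ℕ) (a : Fin s → ℝ) (g : Fin s → Polynomial ℝ), (∑ i, Polynomial.C (a i) * g i ^ 2) = (Literature.Computability.AlgebraicComplexity.tavenasV n).map (Int.castRingHom ℝ) → η * 2 ^ n ≤ ∑ i, ((g i).support.card : ℝ)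

/-- item stmt-ValiantsHypothesis-18748 · crux · rank 2 · open · by planner
why it might fail: Chebyshev T_{2^k} = 2T_{2^{k−1}}² − 1 already forces c ≥ 4 (2^k zeros, support-sum 2^{k−2}+2); three squares contain the open fg+1 problem; one sparse-SOS identity for a Chebyshev/Dickson tower with support o(2^k), s ≥ 3, kills it.
sources: Dutta2021, Burgisser2024Completeness, KoiranPortierTavenas2015, BriquelBurgisser2020, Koiran2011
[crux] Dutta's SOS-τ-conjecture (Dutta2021 Conj. 1; Burgisser2024Completeness Conj. 4.2), typed over
representations so that no `Inf` is needed: there is an absolute c such that for all s, all real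
weights a : Fin s → ℝ and all g : Fin s → ℝ[X], the number of distinct real zeros of Σ_i a_i g_i² is
at most c · Σ_i |supp g_i|. [difficulty: open-problem] -/
@[route_item "route-ValiantsHypothesis-SOSTau", crux]
def SOSTau : Prop :=
  ∃ c : ℕ, ∀ (s : ℕ) (a : Fin s → ℝ) (g : Fin s → Polynomial ℝ), (∑ i, Polynomial.C (a i) * g i ^ 2).roots.toFinset.card ≤ c * ∑ i, (g i).support.card

/-- item stmt-ValiantsHypothesis-18749 · crux · rank 3 · closed · proved by Summit.ValiantsHypothesis.ValiantsHypothesis.Theorems.SOSTauHutchinsonMagnification.HutchinsonMagnification_proof @ cbfbef46e9c4 (prover) · by planner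
why it might fail: Printed over ℂ, ε = 1, size > d^{1/7}; as TYPED it needs Lemma 10 (ℂ→ℝ ×4), VNP_ℂ-membership of the digit lift (free constants) and the middle cut for `complexity` with p-bounded degree (homogenisation ×d²); FeketeSOS's twin took 7 stubs; an exponent slip forces a restatement.
sources: Dutta2021, DuttaSaxenaThierauf2021, DuttaSaxenaThierauf2024, Tavenas2014, Burgisser2000
[crux] Dutta2021 Thm 2 for the tree's witness, over REAL representations and at the LINEAR
threshold: linear sparse-SOS hardness of V_n (the body of HutchinsonSOSHard, inlined) implies VP_ℂ ≠
VNP_ℂ. Printed chain: VP_ℂ = VNP_ℂ ⇒ the kn-variate multilinear digit lift P_{n,k} = φ_{n,k}(V_n) ∈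
VNP_ℂ (Lemma 3; constants 2^{2i(d−i)} free) ⊆ VP_ℂ ⇒ VSBR middle cut P_{n,k} = Σ_{i≤s} c_i Q_i², deg
Q_i ≤ 2n/3, s = O(size·n²) (Lemma 1) ⇒ V_n = Σ c_i ψ(Q_i)² over ℂ with support-sum ≤ s·C(kn+2n/3,
2n/3) = O(d^{6/7} log² d) (Lemma 4, k ≥ 5^14 + 1) ⇒ a REAL representation with ≤ 4× that support
(Lemma 10) ⇒ contradiction with η·2^n for large n. [difficulty: L] -/
@[route_item "route-ValiantsHypothesis-SOSTau", crux]
def HutchinsonMagnification : Prop :=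
  (∃ η : ℝ, 0 < η ∧ ∃ n₀ : ℕ, ∀ n : ℕ, n₀ ≤ n → ∀ (s : ℕ) (a : Fin s → ℝ) (g : Fin s → Polynomial ℝ), (∑ i, Polynomial.C (a i) * g i ^ 2) = (Literature.Computability.AlgebraicComplexity.tavenasV n).map (Int.castRingHom ℝ) → η * 2 ^ n ≤ ∑ i, ((g i).support.card : ℝ)) → ValiantsHypothesis

-- `HutchinsonMagnification` holds: proved by `Summit.ValiantsHypothesis.ValiantsHypothesis.Theorems.SOSTauHutchinsonMagnification.HutchinsonMagnification_proof` @ cbfbef46e9c4 (its module imports this route file, so no `_holds` link can be stated here).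

/-- item stmt-ValiantsHypothesis-18750 · support · rank 9 · closed · proved by Summit.ValiantsHypothesis.ValiantsHypothesis.Theorems.SOSTauHutchinsonMagnification.stub_complexToReal (prover) · by planner
sources: Dutta2021
[support] Dutta2021 Lemma 10, quantitative: a complex weighted SOS representation Σ_{i<s} a_i g_i²
of a REAL polynomial f yields a real one with support-sum at most 4·Σ|supp g_i| (write g_i = u_i + i
v_i, a_i = α_i + iβ_i; Re(a_i g_i²) = α_i(u_i² − v_i²) − (β_i/2)((u_i+v_i)² − (u_i−v_i)²), all four
squares supported inside supp g_i). First birth stub of HutchinsonMagnification. [difficulty: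
provable-now] -/
@[route_item "route-ValiantsHypothesis-SOSTau"]
def ComplexToRealSOS : Prop :=
  ∀ (f : Polynomial ℝ) (s : ℕ) (a : Fin s → ℂ) (g : Fin s → Polynomial ℂ), (∑ i, Polynomial.C (a i) * g i ^ 2) = f.map (algebraMap ℝ ℂ) → ∃ (s' : ℕ) (a' : Fin s' → ℝ) (g' : Fin s' → Polynomial ℝ), (∑ i, Polynomial.C (a' i) * g' i ^ 2) = f ∧ ∑ i, (g' i).support.card ≤ 4 * ∑ i, (g i).support.card

-- `ComplexToRealSOS` holds: proved by `Summit.ValiantsHypothesis.ValiantsHypothesis.Theorems.SOSTauHutchinsonMagnification.stub_complexToReal` (its module imports this route file, so no `_holds` link can be stated here).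

/-- item stmt-ValiantsHypothesis-18751 · support · rank 9 · closed · proved by Summit.ValiantsHypothesis.ValiantsHypothesis.Theorems.SOSTauHutchinsonMagnification.collapseCheapComplexSOS (prover) · by planner
sources: Dutta2021, DuttaSaxenaThierauf2024, Burgisser2000
[support] Dutta2021 Lemmas 1 + 3 + 4 for V_n (the L-sized core of HutchinsonMagnification, its
second birth stub): if VP_ℂ = VNP_ℂ then for every η > 0, infinitely often in n, V_n has a complex
weighted SOS representation of support-sum < η·2^n (digit lift in VNP_ℂ, hence VP_ℂ; VSBR middle
cut; polarisation; inverse digit map; support count O(d^{6/7} log² d)). Reusable tree pieces: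
FeketeSOSSOSMagnificationStubPolarisedSOS, StubDigitKronecker, StubBudget (accepted for FeketeSOS).
[difficulty: L] -/
@[route_item "route-ValiantsHypothesis-SOSTau"]
def CollapseCheapComplexSOS : Prop :=
  Literature.Computability.AlgebraicComplexity.VP ℂ = Literature.Computability.AlgebraicComplexity.VNP ℂ → ∀ η : ℝ, 0 < η → ∀ n₀ : ℕ, ∃ n : ℕ, n₀ ≤ n ∧ ∃ (s : ℕ) (a : Fin s → ℂ) (g : Fin s → Polynomial ℂ), (∑ i, Polynomial.C (a i) * g i ^ 2) = (Literature.Computability.AlgebraicComplexity.tavenasV n).map (Int.castRingHom ℂ) ∧ (∑ i, ((g i).support.card : ℝ)) < η * 2 ^ n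

-- `CollapseCheapComplexSOS` holds: proved by `Summit.ValiantsHypothesis.ValiantsHypothesis.Theorems.SOSTauHutchinsonMagnification.collapseCheapComplexSOS` (its module imports this route file, so no `_holds` link can be stated here).

/-- item stmt-ValiantsHypothesis-18752 · support · rank 9 · closed · proved by Summit.ValiantsHypothesis.ValiantsHypothesis.Theorems.SOSTau.ofSOSTau_proof (prover) · by planner
sources: Dutta2021, Tavenas2014
[support] SOS-τ gives the target: with c from SOSTau take η = 1/(2(c+1)) and n₀ = 1; a real
representation of V_n has 2^n − 1 distinct real zeros (tree `card_roots_toFinset_map_tavenasV`), so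
2^n − 1 ≤ c·S and S ≥ 2^n/(2(c+1)). PROVED sorry-free in Sketch.lean (`ofSOSTau_proof`, 14 lines)
and inlined in `closes`. [difficulty: provable-now] -/
@[route_item "route-ValiantsHypothesis-SOSTau"]
def OfSOSTau : Prop :=
  (∃ c : ℕ, ∀ (s : ℕ) (a : Fin s → ℝ) (g : Fin s → Polynomial ℝ), (∑ i, Polynomial.C (a i) * g i ^ 2).roots.toFinset.card ≤ c * ∑ i, (g i).support.card) → ∃ η : ℝ, 0 < η ∧ ∃ n₀ : ℕ, ∀ n : ℕ, n₀ ≤ n → ∀ (s : ℕ) (a : Fin s → ℝ) (g : Fin s → Polynomial ℝ), (∑ i, Polynomial.C (a i) * g i ^ 2) = (Literature.Computability.AlgebraicComplexity.tavenasV n).map (Int.castRingHom ℝ) → η * 2 ^ n ≤ ∑ i, ((g i).support.card : ℝ)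

-- `OfSOSTau` holds: proved by `Summit.ValiantsHypothesis.ValiantsHypothesis.Theorems.SOSTau.ofSOSTau_proof` (its module imports this route file, so no `_holds` link can be stated here).

/-- item stmt-ValiantsHypothesis-18753 · support · rank 9 · closed · proved by Summit.ValiantsHypothesis.ValiantsHypothesis.Theorems.SOSTau.twoSquares_proof (prover) · by planner
sources: Dutta2021, Koiran2011
[support] Dutta2021 Thm 9 (the largest proved case of SOS-τ): a weighted sum of TWO sparse squares
a₁g₁² + a₂g₂² has at most c·(|supp g₁| + |supp g₂|) distinct real zeros for an absolute c (opposite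
signs: difference-of-squares factorisation into two (t₁+t₂)-sparse factors + sparse Descartes; equal
signs: SameSignSquares). The calibration rung below which refuters need not look. [difficulty:
provable-now] -/
@[route_item "route-ValiantsHypothesis-SOSTau"]
def TwoSquares : Prop :=
  ∃ c : ℕ, ∀ (a₁ a₂ : ℝ) (g₁ g₂ : Polynomial ℝ), (Polynomial.C a₁ * g₁ ^ 2 + Polynomial.C a₂ * g₂ ^ 2).roots.toFinset.card ≤ c * (g₁.support.card + g₂.support.card)

-- `TwoSquares` holds: proved by `Summit.ValiantsHypothesis.ValiantsHypothesis.Theorems.SOSTau.twoSquares_proof` (its module imports this route file, so no `_holds` link can be stated here).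

/-- item stmt-ValiantsHypothesis-18754 · support · rank 9 · closed · proved by Summit.ValiantsHypothesis.ValiantsHypothesis.Theorems.SOSTau.sameSignSquares_proof (prover) · by planner
sources: Dutta2021, Koiran2011
[support] weighted sums of sparse squares with all weights ≥ 0 have at most 2·Σ|supp g_i| distinct
real zeros (every zero is a common zero of the g_i with a_i ≠ 0; sparse Descartes
`card_roots_toFinset_le_of_card_support` on one of them). With TwoSquares it confines the
conjecture's difficulty to s ≥ 3 with mixed signs; the s = 1 case (c = 2) is PROVED in Sketch.lean
(`oneSquare`, `sosTau_one_square`). [difficulty: provable-now] -/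
@[route_item "route-ValiantsHypothesis-SOSTau"]
def SameSignSquares : Prop :=
  ∀ (s : ℕ) (a : Fin s → ℝ) (g : Fin s → Polynomial ℝ), (∀ i, 0 ≤ a i) → (∑ i, Polynomial.C (a i) * g i ^ 2).roots.toFinset.card ≤ 2 * ∑ i, (g i).support.card

-- `SameSignSquares` holds: proved by `Summit.ValiantsHypothesis.ValiantsHypothesis.Theorems.SOSTau.sameSignSquares_proof` (its module imports this route file, so no `_holds` link can be stated here).

/-- item stmt-ValiantsHypothesis-18755 · support · rank 9 · closed · proved by Summit.ValiantsHypothesis.ValiantsHypothesis.Theorems.SOSTau.chebyshevCalibration_proof (prover) · by planner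
sources: Koiran2011, Burgisser2024Completeness, Dutta2021
[support] the barrier witness of `Literature.Barriers.ValiantsHypothesis.TauRealZeros` re-measured
in the SOS model: T_{2^k} = 2·T_{2^{k−1}}² − 1·1² is a two-square representation of support-sum
2^{k−2} + 2 of a polynomial with 2^k distinct real zeros (tree `card_realRoots_chebyshevT`; Mathlib
`Polynomial.Chebyshev`), hence every admissible SOS-τ constant satisfies c ≥ 4 — the conjecture
lives exactly at the Chebyshev ratio, and two-square representations can never beat it (TwoSquares'
factorisation gives ≤ 26 < 32 zeros at k = 5). [difficulty: provable-now] -/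
@[route_item "route-ValiantsHypothesis-SOSTau"]
def ChebyshevCalibration : Prop :=
  ∀ c : ℕ, (∀ (s : ℕ) (a : Fin s → ℝ) (g : Fin s → Polynomial ℝ), (∑ i, Polynomial.C (a i) * g i ^ 2).roots.toFinset.card ≤ c * ∑ i, (g i).support.card) → 4 ≤ c

-- `ChebyshevCalibration` holds: proved by `Summit.ValiantsHypothesis.ValiantsHypothesis.Theorems.SOSTau.chebyshevCalibration_proof` (its module imports this route file, so no `_holds` link can be stated here).

/-- item stmt-ValiantsHypothesis-18756 · assembly · rank 1 · closed · proved by Summit.ValiantsHypothesis.ValiantsHypothesis.Theorems.SOSTau.assembly_proof (prover) · by planner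
sources: Dutta2021
[assembly] SOSTau → HutchinsonMagnification → ValiantsHypothesis (proved: Sketch.lean
`assembly_proof`). -/
@[route_item "route-ValiantsHypothesis-SOSTau"]
def Assembly : Prop :=
  SOSTau → HutchinsonMagnification → ValiantsHypothesis

-- `Assembly` holds: proved by `Summit.ValiantsHypothesis.ValiantsHypothesis.Theorems.SOSTau.assembly_proof` (its module imports this route file, so no `_holds` link can be stated here).

/-! D-0027 §2.1 — DECIDING THEOREM (planner-authored via `route open/edit --closes-file`; by planner-plan-lens3-ValiantsHypothesis-complete-g2-0 2026-08-17T02:58:10Z):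
its hypotheses are this route's items and its conclusion the sub-problem Statement (glue_lint), and it elaborates with this file. -/

@[closes "route-ValiantsHypothesis-SOSTau"] theorem closes (h₁ : SOSTau) (h₂ : HutchinsonMagnification) : _root_.ValiantsHypothesis := by
  refine h₂ ?_
  obtain ⟨c, hc⟩ := h₁
  refine ⟨1 / (2 * ((c : ℝ) + 1)), by positivity, 1, fun n hn s a g hrep => ?_⟩
  have hZ := hc s a g
  rw [hrep, Literature.Computability.AlgebraicComplexity.card_roots_toFinset_map_tavenasV] at hZ
  have h1 : (1 : ℕ) ≤ 2 ^ n := Nat.one_le_two_pow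
  have hZ' : (2 : ℝ) ^ n - 1 ≤ (c : ℝ) * ∑ i, ((g i).support.card : ℝ) := by
    have := (Nat.cast_le (α := ℝ)).mpr hZ
    push_cast [Nat.cast_sub h1] at this
    exact this
  have h2 : (2 : ℝ) ≤ 2 ^ n := by
    calc (2 : ℝ) = 2 ^ 1 := by norm_num
      _ ≤ 2 ^ n := pow_le_pow_right₀ (by norm_num) hn
  have hS : 0 ≤ ∑ i, ((g i).support.card : ℝ) := by positivity
  rw [div_mul_eq_mul_div, one_mul, div_le_iff₀ (by positivity)]
  nlinarith [mul_nonneg (Nat.cast_nonneg c) hS]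

end Summit.ValiantsHypothesis.ValiantsHypothesis.Theses.SOSTau
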